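import Mathlib
import HarnessLib
import HarnessLib.Audit
import Summits.Parity.Statement

/-!
Route: SelbergDelange

CLOSED (retired) 2026-08-15T13:50:34Z by operator:999:1257524 — reason: not-a-thesis: assembly does not conclude the sub-problem Statement — note: D-0027 §2.1 audit (human 2026-08-15: routes that do not decide the summit are removed): the assembly concludes `Literature.NumberTheory.Sieve.HardyLittlewoodConjE`, not the sub-problem statement; a NEW conforming route may be opened from the same idea (generated `closes : … → _root_.BatemanHorn`).. The file is kept as the record of this route; refuted decls are indexed as negative knowledge (`ledger negatives`).

X_SD (SelbergDelange; realises idea card Parity/BatemanHorn/selberg-delange-rigidity). First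
instance F = X²+1 (Hardy–Littlewood E ⊂ BatemanHorn). Put M_x(z) := Σ_{1≤n≤x} z^{ω(n²+1)} (for each
x a POLYNOMIAL in z ∈ ℂ; ω = number of distinct prime factors, π_j(x) := #{n ≤ x : ω(n²+1) = j} its
coefficients), the normalised family H_x(z) := x⁻¹ (2 log x)^{1−z} M_x(z), and λ(z) := ∏_p (1 +
(z−1)ρ(p)/p)(1 − 1/p)^{z−1} (ordered Euler product, ρ(p) = #{ν mod p : ν²+1 ≡ 0}; λ is entire, λ(1)
= 1, and λ(0) = ∏_p (1 − ρ(p)/p)(1 − 1/p)⁻¹ = 𝔖 = hardyLittlewoodEConst). The conjectural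
Landau–Selberg–Delange law ALONG n²+1 is H_x(z) → λ(z)/Γ(z) locally uniformly in z (at z = k+1 ∈ ℕ
it is the k-fold divisor-sum heuristic, e.g. z = 2: Σ 2^{ω(n²+1)} ~ 2λ(2) x log x, Hooley's divisor
problem for n²+1; the factor 1/Γ(z) is the large-prime correction exactly as in Selberg's Σ_{n≤x}
z^{ω(n)} = x(log x)^{z−1}(λ_ℤ(z)/Γ(z) + O(1/log x))). Since π₀(x) = 0, H_x'(0) = (2 log x/x)·π₁(x),
and π₁ counts n ≤ x with n²+1 a prime power: HL-E (#{n ≤ x : n²+1 prime} ~ (𝔖/2) x/log x) is EXACTLY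
the statement H_x'(0) → (λ/Γ)'(0) = λ(0) — Bateman–Horn is the Taylor coefficient of the law at the
zero of 1/Γ, as PNT is for Selberg's formula. RIGIDITY: if H_x converges on an open set U and {H_x}
is a NORMAL family (locally bounded) on a domain V ⊃ U ∪ {0}, then by Vitali–Porter H_x converges
locally uniformly on V together with all derivatives, and the coefficient at 0 drops out. It
therefore suffices to show X_SD := LSDOpenSet ∧ NormalFamilyBound: (L1 = LSDOpenSet) the LSD law
H_x(z) → λ(z)/Γ(z) uniformly on the closed disc U = {|z − 3/2| ≤ 1/4} — PARITY-FREE (reweighting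
n²+1 by 1 ± λ_Liouville moves H_x(z) by (log x)^{−2Re z} only) but LEVEL-limited: z^{ω(m)} = Σ_{d|m,
d squarefree} (z−1)^{ω(d)} needs the root counts A_d(x) = #{n ≤ x : d | n²+1} for d up to x², and
for d > x^{1+ε} the complex weight (z−1)^{ω(d)} does not switch to the cofactor unless z = 2; (L2 =
NormalFamilyBound) the ONE-SIDED bounds |M_x(z)| ≤ C x (2 log x)^{Re z − 1} uniformly on closed
sub-rectangles of V = {−1/4 < Re z < 7/4, |Im z| < 1/4} (on the real segment (0, 7/4) this is
Nair–Tenenbaum's theorem; off the axis it asks a saving (log x)^{|z| − Re z} over the trivial bound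
(at most (log x)^{1/4} on V ∩ {Re z ≥ 0}, at most (log x)^{0.61} in the corners Re z → −1/4) — the
'cost of leaving the real axis' is a continuous dial; for Re z ≤ 0 it is a parity statement:
alternating cancellation Σ_j (−r)^j π_j(x) ≪ x (log x)^{−1−r} among the almost-prime counts of
n²+1). Given X_SD, the supports EulerFactorAtZero (λ entire, λ(0) = 𝔖) and VitaliExtraction
(Vitali–Porter + Weierstrass) yield H_x'(0) → 𝔖, and prime powers n²+1 = p^k with k ≥ 2 are
O(x^{2/3} log x) (k = 2 is impossible), whence Literature.NumberTheory.Sieve.HardyLittlewoodConjE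
(via hardyLittlewoodConjE_iff_isEquivalent). General (k, f): M_x(z₁,…,z_k) = Σ_n ∏ z_i^{ω(f_i(n))},
log x ↦ deg f_i · log x, Vitali/Hartogs in several variables — not decomposed here.
Lean (X_SD = LSDOpenSet ∧ NormalFamilyBound; both decls elaborate against Mathlib + Literature):
LSDOpenSet := ∃ Λf : ℂ → ℂ, (∀ z ∈ Metric.closedBall (3 / 2 : ℂ) (1 / 4), Filter.Tendsto (fun y : ℕ
=> ∏ p ∈ Nat.primesLE y, ((1 + (z - 1) * ((Literature.NumberTheory.Sieve.polyRootCountMod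
![(Polynomial.X ^ 2 + 1 : Polynomial ℤ)] p : ℕ) : ℂ) / (p : ℂ)) * (1 - 1 / (p : ℂ)) ^ (z - 1)))
Filter.atTop (nhds (Λf z))) ∧ TendstoUniformlyOn (fun x : ℕ => fun z : ℂ => ((2 * Real.log x : ℝ) :
ℂ) ^ (1 - z) / (x : ℂ) * ∑ n ∈ Finset.Icc 1 x, z ^ (ArithmeticFunction.cardDistinctFactors (n ^ 2 +
1))) (fun z : ℂ => Λf z / Complex.Gamma z) Filter.atTop (Metric.closedBall (3 / 2 : ℂ) (1 / 4))
NormalFamilyBound := ∀ δ : ℝ, 0 < δ → ∃ C : ℝ, ∀ x : ℕ, 2 ≤ x → ∀ z : ℂ, -(1 / 4 : ℝ) + δ ≤ z.re →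
z.re ≤ 7 / 4 - δ → |z.im| ≤ 1 / 4 - δ → ‖((2 * Real.log x : ℝ) : ℂ) ^ (1 - z) / (x : ℂ) * ∑ n ∈
Finset.Icc 1 x, z ^ (ArithmeticFunction.cardDistinctFactors (n ^ 2 + 1))‖ ≤ C

Rationale: WHY THIS LINE (area imported: complex function theory — normal families / Vitali–Porter analytic
continuation in an auxiliary parameter z; Selberg's z^ω method [Tenenbaum2015, II.5–II.6], Selberg
1954). Every BatemanHorn-side route attacks ONE signed statement (a Möbius tail or atom at 'z =
−1'). Selberg–Delange embeds the prime count into an entire-function-valued statistic z ↦ M_x(z) and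
splits HL-E into two obligations of DIFFERENT shape: an asymptotic on an open set U ⊂ {Re z > 1}
where parity conspiracies are provably invisible at leading order (a LEVEL problem: complex-weighted
divisor sums of n²+1 with d up to x², the Type-I₂/I₃ wall of [Merikoski2022]/arXiv:1908.08816 §4,
Hooley 1963 being the solved point z = 2), and mere UPPER BOUNDS on a thin neighbourhood V of [0,
U], where parity lives at an explicit exchange rate (log x)^{|z|−Re z}. Compactness (Vitali) does
the gluing, theorem-grade. Known anchor points: z = 1 trivial, z = 2 Hooley, real z > 0 order of
magnitude (Nair–Tenenbaum 1998, [HallTenenbaum1988]-type), Erdős–Kac for ω(n²+1) (Halberstam 1956) =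
the law on the shrinking arc z = e^{it/√loglog x}; mod-Poisson frame arXiv:0807.4739. lit
frontier/bridges Parity (2026-08-15): no descendant on LSD laws along polynomial values.
RANKED CRUXES. r2 LSDOpenSet (the distinctive, parity-free crux: LSD law on |z − 3/2| ≤ 1/4 with the
explicit limit λ(z)/Γ(z); new estimate needed = balanced squarefree d ∈ [x^{1−ε}, x^{2}] with
complex damping (z−1)^{ω(d)}, j = 2 large primes). r3 NormalFamilyBound (one-sided bounds on V ∋ 0;
hardest; where any mechanism for SIGNED almost-prime counts of n²+1 — Type-I₂ beyond x, exceptional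
characters, bilinear structure on moduli — can be fed in without producing an asymptotic). support
r9: EulerFactorAtZero (λ entire with λ(0) = hardyLittlewoodEConst: Σ_p (ρ(p)−1)/p = Σ χ₋₄(p)/p
converges — tendsto_hardyLittlewoodE_partial_holds / exists_hasBatemanHornConst_holds; provable
now), VitaliExtraction (Vitali–Porter–Montel + derivative convergence, pure complex analysis;
Mathlib has TendstoLocallyUniformlyOn.deriv and Arzelà–Ascoli, not Montel; provable now with
effort). r1 Assembly: LSDOpenSet → NormalFamilyBound → EulerFactorAtZero → VitaliExtraction →
HardyLittlewoodConjE (bookkeeping: shift x ≥ 2, U° = open ball, Ψ = λ·(1/Γ) entire by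
Complex.differentiable_one_div_Gamma, (1/Γ)'(0) = 1 by
one_div_Gamma_eq_self_mul_one_div_Gamma_add_one, H_x'(0) = (2 log x/x)π₁(x) since π₀ = 0, prime
powers n²+1 = p^k (k ≥ 3) ≤ O(x^{2/3} log x) and k = 2 impossible, then
hardyLittlewoodConjE_iff_isEquivalent).
KILL CRITERIA. r2 refuted (H_x provably does NOT converge to λ/Γ somewhere on U, e.g. a different
large-prime correction than 1/Γ(z), visible numerically at x = 10⁹ on real z ∈ [5/4, 7/4]) ⇒ my
normalisation of the law is wrong ⇒ PIVOT (re-derive the limit function; the Vitali frame survives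
with any analytic limit whose derivative at 0 is 𝔖), do not close. r3 refuted by an Ω-result at some
z₀ ∈ V with Re z₀ > 0 (a genuine failure of normality off the real axis, i.e. a (log x)^{|z|−Re
z}-size oscillation that does not cancel) ⇒ the rigidity mechanism is dead for n²+1 ⇒ CLOSE (census:
which z₀). r3 refuted only at Re z₀ ≤ 0 ⇒ equivalent to an Ω-result for signed almost-prime counts
of n²+1 contradicting HL-E-with-log-saving ⇒ file the negation against HardyLittlewoodConjE-strength
statements and close. EulerFactorAtZero/VitaliExtraction refuted ⇒ bookkeeping error ⇒ re-file.
NOT DECOMPOSED YET. (i) r2 into [real-segment asymptotic z ∈ [5/4, 7/4] (divisor-switching + joint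
law of small part / number of primes > x^{1−ε})] + [off-axis (log x)^{1/4}-saving]; (ii) r3 into the
Nair–Tenenbaum half (Re z > 0, provable pieces) and the parity half (Re z ≤ 0); (iii) the
several-variables version for k ≥ 2 and general f (log x ↦ deg f·log x); (iv) the
Dirichlet-coefficient variant of the card (square-part moments of p − 1 ⇒ every π_{kX²+1}) — a
different extraction principle, left on the card.

Novelty: NOVELTY (searches: card audit by refuter-novelty-audit-Parity-BatemanHorn-1-0, 2026-08-15 — zbMATH
'Selberg-Delange method polynomial values number of prime factors', 'mod-Poisson convergence number
of prime divisors polynomial', 'distribution of omega(n^2+1) Erdős-Kac': 0 hits each; this session: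
`lit frontier Parity --since 2020` (30 descendants, none on LSD laws along f(n)), `lit vsearch` ×3
(Ivić/Tenenbaum-type integer LSD only), `lit galaxy search --star all` (0 rows); `lit search`
searchd rc 75 all session — flagged). Nearest prior art FOUND: Tenenbaum2015 ch. II.5–II.6 and
Selberg 1954 (the z^ω method and coefficient extraction for the INTEGERS: PNT/Landau π_k as Taylor
coefficients at the zero of 1/Γ); HallTenenbaum1988 / Nair–Tenenbaum, Acta Math. 180 (1998) (orders
of magnitude for Σ g(|F(n)|), no asymptotic); arXiv:0807.4739 (mod-Poisson convergence, integers and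
function fields, not polynomial values); Hooley 1963 (z = 2 for n²+1); arXiv:1908.08816 (the level-x
Type-I₂ wall for n²+1). DELTA: no LSD-type ASYMPTOTIC for Σ z^{ω(F(n))}, F irreducible of degree ≥
2, exists or is posed in print, and nowhere is BH phrased as analytic continuation in z; the route's
new content is the SHAPE — HL-E = [parity-free LSD law on an open U ⊂ {Re z>1}] + [one-sided
normality bounds on V ∋ 0] glued by Vitali–Porter, with the explicit exchange rate (log x)^{|z|−Re
z} and a typed, theorem-grade extraction (π₀ = 0 ⇒ H_x'(0) = (2 log x/x)π₁). Card grade: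
new-combination (ingredients cl  [refs: 0807.4739, 1908.08816, Tenenbaum2015, HallTenenbaum1988]

Barriers (technique_class: analytic-continuation normal-families selberg-delange): BARRIERS (catalogue Literature/Barriers/Parity read 2026-08-15; technique_class:
analytic-continuation normal-families selberg-delange).
- Literature.Barriers.Parity.SelbergParityBarrier: APPLIES to NormalFamilyBound on Re z ≤ 0 and is
NOT evaded there — Selberg's 1 ± λ reweightings of n²+1 change Σ z^{ω} by a term of relative size
(log x)^{−2Re z}, which for Re z ≤ 0 violates the bound, so r3 is exactly where non-Type-I input
must enter; it does NOT apply to LSDOpenSet (U ⊂ {Re z ≥ 5/4}: the same computation shows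
conspiracies are invisible at leading order). The route's claim is the clean SEPARATION with a
quantified exchange rate, not an evasion.
- Literature.Barriers.Parity.FordFixedLevelBarrier: not engaged literally (no Λ_k-asymptotic is
drawn from a fixed level); in substance LSDOpenSet needs divisor-level information BEYOND x (d ∈ (x,
x²] squarefree with complex weights), i.e. it names the missing level rather than assuming it.
- Literature.Barriers.Parity.FordMaynardLowLevel /
Literature.Barriers.Parity.FordMaynardMinimalTypeII: APPLY to any Type-I/II derivation of primes in
the thin set {n²+1} (c = 1/2); the route never detects primes by (I)/(II): the prime count is read
off as a Taylor coefficient of a family whose parity-free part (r2) is an UNSIGNED-type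
complex-weighted divisor statistic and whose signed part (r3) is an upper bound; honest form: r3
does not evade them, it asks for less than an asymptotic.
- Literature.Barriers.Parity.LogarithmicAveraging: the st

History (route lifecycle, newest last):
- 2026-08-15T13:50:34Z · CLOSED retired — not-a-thesis: assembly does not conclude the sub-problem Statement (operator:999:1257524)

sub-problem: BatemanHorn · status: closed(retired) · opened planner-plancards-Parity-BatemanHorn-20260815w1-2-0 2026-08-15T10:37:42Z · rev 1 · ledger route-Parity-SelbergDelange
GENERATED by the gate from the ledger (D-0016/17). Provers cite these decls: `theorem foo : Summit.Parity.BatemanHorn.Theses.SelbergDelange.<Decl> := …` in Summits/Parity/BatemanHorn/Theorems/<Name>.lean.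
-/

namespace Summit.Parity.BatemanHorn.Theses.SelbergDelange

open scoped BigOperators Topology Manifold Classical MeasureTheory ProbabilityTheory Matrix InnerProductSpace ComplexConjugate ContinuousMap
open Filter Set Function TopologicalSpace MeasureTheory

attribute [summit_statement] _root_.BatemanHorn

/-- item stmt-Parity-0963 · crux · rank 2 · closed · moot by None · by planner
why it might fail: Needs A_d(x)=#{n≤x: d|n²+1} against complex weights (z−1)^{ω(d)}, squarefree d up to x²; past d≈x no divisor switching unless z=2 (Hooley1963 the one solved point; Type-I₂ wall, arXiv:1908.08816 §4). The limit λ/Γ presumes PD(1) large prime factors of n²+1 — unproved; numerics may disagree.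
sources: Tenenbaum2015, Selberg1954, Hooley1963, NairTenenbaum1998, HallTenenbaum1988, Merikoski2022
[crux] Landau–Selberg–Delange law along n²+1 on an open set (parity-free): with ρ(p) =
polyRootCountMod ![X²+1] p and λ_y(z) := ∏_{p≤y}(1 + (z−1)ρ(p)/p)(1 − 1/p)^{z−1}, the limits λ(z) =
lim_y λ_y(z) exist on the closed disc |z − 3/2| ≤ 1/4 and H_x(z) := x⁻¹(2 log x)^{1−z} Σ_{1≤n≤x}
z^{ω(n²+1)} → λ(z)/Γ(z) UNIFORMLY there. Consistency: z = 1 trivial, z = 2 ⇔ Σ 2^{ω(n²+1)} ~ 2λ(2) x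
log x (Hooley 1963-type), z = k+1 ⇔ the k-fold divisor heuristic with 1/Γ(k+1) = 1/k!. Content:
z^{ω(m)} = Σ_{d|m sqfree}(z−1)^{ω(d)} needs A_d(x) for d ≤ x² — d ≤ x^{1−ε} Type-I, d ∈
[x^{1−ε},x^{1+ε}] DFI/Tóth/Grimmelt–Merikoski window with oscillating weights, d > x^{1+ε} a
cofactor-factorisation problem (no switching for z ≠ 2): a tiny (log x)^{|z|−Re z}-type cancellation
beyond level x. Sources: Tenenbaum2015 II.5–6; Selberg 1954; Nair–Tenenbaum 1998; arXiv:1908.08816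
§4. -/
@[route_item "route-Parity-SelbergDelange"]
def LSDOpenSet : Prop :=
  ∃ Λf : ℂ → ℂ, (∀ z ∈ Metric.closedBall (3 / 2 : ℂ) (1 / 4), Filter.Tendsto (fun y : ℕ => ∏ p ∈ Nat.primesLE y, ((1 + (z - 1) * ((Literature.NumberTheory.Sieve.polyRootCountMod ![(Polynomial.X ^ 2 + 1 : Polynomial ℤ)] p : ℕ) : ℂ) / (p : ℂ)) * (1 - 1 / (p : ℂ)) ^ (z - 1))) Filter.atTop (nhds (Λf z))) ∧ TendstoUniformlyOn (fun x : ℕ => fun z : ℂ => ((2 * Real.log x : ℝ) : ℂ) ^ (1 - z) / (x : ℂ) * ∑ n ∈ Finset.Icc 1 x, z ^ (ArithmeticFunction.cardDistinctFactors (n ^ 2 + 1))) (fun z : ℂ => Λf z / Complex.Gamma z) Filter.atTop (Metric.closedBall (3 / 2 : ℂ) (1 / 4))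

/-- item stmt-Parity-0964 · crux · rank 3 · closed · moot by None · by planner
why it might fail: At Re z=−r≤0 it asks |Σ_j(−r)^j π_j(x)| ≪ x(log x)^{−1−r}: (log x)^r cancellation among almost-prime counts of n²+1 (HL-E-with-log-saving strength); 1±λ reweightings (SelbergParityBarrier) violate it ⇒ no Type-I proof. Off-axis, Re z>0: needs (log x)^{|z|−Re z} beyond NairTenenbaum1998 Thm 1.
sources: NairTenenbaum1998, Henriot2012, Tenenbaum2015, Ford2004, BombieriAsymptoticSieve1976, arXiv:1908.08816
[crux] Normality (one-sided bounds) on V = {−1/4 < Re z < 7/4, |Im z| < 1/4} ⊃ U ∪ {0}: for every δ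
> 0 there is C with ‖x⁻¹(2 log x)^{1−z} Σ_{1≤n≤x} z^{ω(n²+1)}‖ ≤ C for all x ≥ 2 and all z in the
δ-shrunk closed rectangle, i.e. |Σ_{n≤x} z^{ω(n²+1)}| ≪_K x (2 log x)^{Re z − 1} on compacta K ⊂ V.
On the real segment z ∈ (0, 7/4) this is Nair–Tenenbaum's order-of-magnitude theorem; for Im z ≠ 0
it asks a saving (log x)^{|z|−Re z} over the trivial bound Σ|z|^{ω} (at most (log x)^{1/4} on V ∩
{Re z ≥ 0}, up to (log x)^{0.61} in the corners Re z → −1/4); for Re z = −r ≤ 0 it is |Σ_j (−r)^j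
π_j(x)| ≪ x(log x)^{−1−r}: alternating cancellation among the almost-prime counts π_j = #{n ≤ x :
ω(n²+1) = j} — the PARITY content of the route (where Type-I₂-beyond-x, exceptional-character or
bilinear-on-moduli mechanisms can be fed in without an asymptotic). Sources: Nair–Tenenbaum 1998;
Tenenbaum2015 II.6; Literature.Barriers.Parity.SelbergParityBarrier. -/
@[route_item "route-Parity-SelbergDelange"]
def NormalFamilyBound : Prop :=
  ∀ δ : ℝ, 0 < δ → ∃ C : ℝ, ∀ x : ℕ, 2 ≤ x → ∀ z : ℂ, -(1 / 4 : ℝ) + δ ≤ z.re → z.re ≤ 7 / 4 - δ → |z.im| ≤ 1 / 4 - δ → ‖((2 * Real.log x : ℝ) : ℂ) ^ (1 - z) / (x : ℂ) * ∑ n ∈ Finset.Icc 1 x, z ^ (ArithmeticFunction.cardDistinctFactors (n ^ 2 + 1))‖ ≤ C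

/-- item stmt-Parity-0965 · support · rank 9 · closed · moot by None · by planner
[support] The Euler factor of the law is entire and takes the Conjecture E constant at 0: the
partial products λ_y(z) = ∏_{p≤y}(1 + (z−1)ρ(p)/p)(1 − 1/p)^{z−1} (ρ(p) = polyRootCountMod ![X²+1]
p; principal cpow of the positive real 1 − 1/p) converge locally uniformly on ℂ to a differentiable
Λ with Λ(0) = hardyLittlewoodEConst. Proof sketch: for |z| ≤ R and p > p₀(R), log of the p-factor =
(z−1)(ρ(p)−1)/p + O_R(1/p²); Σ_p (ρ(p)−1)/p = Σ_p χ₋₄(p)/p converges (ordered) — e.g. from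
tendsto_hardyLittlewoodE_partial_holds (log of ∏_{2<p≤x}(1 − χ₋₄(p)/(p−1)) converges) or Mertens for
ℚ(i); at z = 0 the partial product is literally batemanHornPartial ![X²+1] y, so Λ(0) =
batemanHornConst ![X²+1] = hardyLittlewoodEConst (exists_hasBatemanHornConst_holds,
HasBatemanHornConst.batemanHornConst_eq). Provable now (moderate effort). -/
@[route_item "route-Parity-SelbergDelange"]
def EulerFactorAtZero : Prop :=
  ∃ Λf : ℂ → ℂ, Differentiable ℂ Λf ∧ TendstoLocallyUniformly (fun y : ℕ => fun z : ℂ => ∏ p ∈ Nat.primesLE y, ((1 + (z - 1) * ((Literature.NumberTheory.Sieve.polyRootCountMod ![(Polynomial.X ^ 2 + 1 : Polynomial ℤ)] p : ℕ) : ℂ) / (p : ℂ)) * (1 - 1 / (p : ℂ)) ^ (z - 1))) Λf Filter.atTop ∧ Λf 0 = (Literature.NumberTheory.Sieve.hardyLittlewoodEConst : ℂ)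

/-- item stmt-Parity-0966 · support · rank 9 · closed · moot by None · by planner
[support] Vitali–Porter (Montel) + Weierstrass, abstract form used by the Assembly: F_n holomorphic
on an open preconnected V ∋ 0, locally bounded on V (uniform bounds on each compact K ⊆ V),
converging pointwise on a nonempty open U ⊆ V to Ψ holomorphic on V ⟹ deriv (F_n) 0 → deriv Ψ 0.
Proof: Cauchy estimates ⇒ local equicontinuity ⇒ Arzelà–Ascoli (Mathlib:
BoundedContinuousFunction.arzela_ascoli) ⇒ every subsequence has a locally uniformly convergent
subsequence whose limit is holomorphic (TendstoLocallyUniformlyOn.differentiableOn) and agrees with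
Ψ on U, hence on V (identity theorem, Mathlib AnalyticOnNhd.eqOn_of_preconnected_of_eventuallyEq);
so F_n → Ψ locally uniformly on V and derivatives converge (TendstoLocallyUniformlyOn.deriv / Cauchy
integral formula for the derivative). Mathlib has no Montel theorem yet: a self-contained proof on V
is the work. Pure complex analysis, provable now. -/
@[route_item "route-Parity-SelbergDelange"]
def VitaliExtraction : Prop :=
  ∀ (F : ℕ → ℂ → ℂ) (Ψ : ℂ → ℂ) (V U : Set ℂ), IsOpen V → IsPreconnected V → (0 : ℂ) ∈ V → IsOpen U → U.Nonempty → U ⊆ V → (∀ n, DifferentiableOn ℂ (F n) V) → DifferentiableOn ℂ Ψ V → (∀ K ⊆ V, IsCompact K → ∃ C : ℝ, ∀ n, ∀ z ∈ K, ‖F n z‖ ≤ C) → (∀ z ∈ U, Filter.Tendsto (fun n => F n z) Filter.atTop (nhds (Ψ z))) → Filter.Tendsto (fun n => deriv (F n) 0) Filter.atTop (nhds (deriv Ψ 0))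

/-- item stmt-Parity-0967 · assembly · rank 1 · closed · moot by None · by planner
[assembly] LSDOpenSet → NormalFamilyBound → EulerFactorAtZero → VitaliExtraction →
HardyLittlewoodConjE. Bookkeeping: F_x(z) := H_{x+2}(z) = (x+2)⁻¹(2 log(x+2))^{1−z} Σ_{n≤x+2}
z^{ω(n²+1)} is entire in z (cpow with positive real base, finite sum of monomials); V := the open
rectangle (convex ⇒ preconnected, 0 ∈ V), U := open ball(3/2, 1/4) ⊆ closed ball where LSDOpenSet
gives convergence to Λ₁(z)/Γ(z); local bounds on compacta from NormalFamilyBound (each compact K ⊂ V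
lies in a δ-shrunk rectangle); Ψ := Λ·(Γ)⁻¹ with Λ from EulerFactorAtZero (entire:
Complex.differentiable_one_div_Gamma), Ψ = Λ₁/Γ on U by uniqueness of limits of the same partial
products (tendsto_nhds_unique); VitaliExtraction ⇒ deriv F_x 0 → deriv Ψ 0 = Λ(0)·(1/Γ)'(0) +
Λ'(0)·(1/Γ)(0) = hardyLittlewoodEConst (1/Γ(z) = z/Γ(z+1):
Complex.one_div_Gamma_eq_self_mul_one_div_Gamma_add_one, Γ(1) = 1). On the other side deriv F_x 0 =
(2 log x/x)·π₁(x) because the z⁰-coefficient π₀(x) = #{1 ≤ n ≤ x : ω(n²+1) = 0} = 0 (n²+1 ≥ 2) kills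
the derivative of (2 log x)^{1−z}; π₁(x) = #{n ≤ x : n²+1 a prime power} = nSqAddOnePrimeCount x +
O(x^{2/3} log x) (n²+1 = p² impossible for n ≥ 1; p^k ≤ x²+1 with k ≥ 3 gives ≤ 2x^{2/3} valu -/
@[route_item "route-Parity-SelbergDelange"]
def Assembly : Prop :=
  LSDOpenSet → NormalFamilyBound → EulerFactorAtZero → VitaliExtraction → Literature.NumberTheory.Sieve.HardyLittlewoodConjE

end Summit.Parity.BatemanHorn.Theses.SelbergDelange
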